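import Summits.QuantumFields.YangMills.Theorems.BalabanUVNodesN15TwoSpacingGluingAdjointDefectGluingCutOut
import Summits.QuantumFields.YangMills.Theorems.BalabanUVNodesN15TwoGridGluingGradientGeneralTransport
import HarnessLib

/-!
# N15 = NE2, road (c) — PROGRAMME (PC), (PC-E-K) ENTRY 2 OF (3.42) (`G′∇*_U`, THE ADJOINT ARRANGEMENT) — THE GENERIC LAYER THROUGH A GENERAL TRANSPORT `τ`: n15-c FILES 147 ∕ 149 ∕ 158
# (`…TwoSpacingGluingAdjointDefectGluing(Cut)(Out)`) and FILE 46's `hasMaj_idef_glueInvL_comp` RE-DERIVED VERBATIM with King's block pull-back `pull π` replaced by an ARBITRARY linear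
# transport `τ : (X → ℝ) →ₗ (X′ → ℝ)` and the partition fits `|h′ − h∘π| ≤ o` replaced by the displayed partition-defect ROWS `𝔇_τ(M_{h′_□}, M_{h_□}) ≤ diag o` (dag-n15-c g36, n15-c∕423)

Cell `pub-ymgap`, seat `pub-ymgap-dag-n15-c` (generation g36; R134 (a) seat, strategy s1 «first missing estimate»; HUMAN RULING D-0062; chair R424 venue).
`bears_on: R4∕N15 · K3⁸ SpineGivenEndpointR13SepCoPHV (stmt-QuantumFields-27366)`; filed `--kind proof --supports stmt-QuantumFields-27366 --as helper` — COUNT-NEUTRAL.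
SIX theorems, 0 `def`, 0 `sorry`; bookkeeping over landed single-grid rows, NO new estimate.  Imports BY NAME n15-c FILE 158 `…TwoSpacingGluingAdjointDefectGluingCutOut` (and through it
FILES 147∕149, `…TwoSpacingGluingInputLocalized` (`hasMaj_remainderLD_out`), `…TwoSpacingGluingCutEntries` (`hasMaj_parametrix_comp_cut`, `parametrix_comp_of_leibniz`),
`…TwoSpacingGluingDefect` (`glueInvL`, `neumannR`, `hasMaj_neumannR`, `isUnit_neumannR`), `…TwoSpacingGluingAdjoint` (`remainderL`)), n15-c∕399 `…TwoGridGluingGradientGeneralTransport`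
(`hasMaj_idef_sandwich_loc_tr`; through it n15-c∕332 `…TwoGridGluingGeneralTransport`: `idef_fsum_tr`, `idef_neumannR_tr`); pub-balaban `T4EtaRateDefect` (`idef`, `idef_comp`,
`idef_add`, `idef_sub`), `T4EtaRateCoeffDefect` (`diagK`, `hasMaj_mulOp`).  Nothing in the tree is modified, no landed name re-declared; every `_tr` theorem is its flat namesake with
`pull π ↦ τ` (proof text identical up to that and `hfit ↦ hDh`).

WHY.  n15-c∕422 `ne2PlusOperator_pc₀₁₃` has entries 0, 1, 3 of (3.42) constructed for THE named scalar covariant Green's function on the printed per-cube class and DISPLAYS entry 2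
(`G′∇*_U`).  Entry 2 cannot be transposed from entry 1 (block sup-majorants are not transpose-invariant uniformly in the family index, dag-n15-c g18∕g26) — its route is Bałaban's
ADJOINT ARRANGEMENT `𝒢 = (1 − R̃)⁻¹∘G₀`, in which right factors ride in the parametrix slot (`𝒢∘E = Ñ∘(G₀∘E)`, [Balaban1984PropagatorsII] (2.91)–(2.93)).  The lane's adjoint two-grid
glue (FILES 147∕149∕158, dag-n15-w2's `…AdjointLocalGaugesTwoGrid(Fit)`) is typed for the FLAT transport `pull π`; the (PC-E) chain runs through the COVARIANT transport `τ_{Ad∘U′}`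
(n15-c∕332∕399 did the same transcription for entries 0 and 1).  THIS FILE is the entry-2 keystone of that transcription: the per-piece layer (adjoint twist of right-composed pieces,
the cube-level adjoint capstone through `τ`) follows the landed pattern 401∕402 → 404–411.

WHAT THIS FILE PROVES (kernel) — `τ : (X → ℝ) →ₗ[ℝ] (X′ → ℝ)` arbitrary; coarse blocks `blk`, fine blocks `blk ∘ π`:
* §1 ★★ `hasMaj_idef_parametrix_comp_cut_tr` — the η-defect of the RIGHT-dressed parametrix `G₀∘E` from cut ∕ sandwiched rows (FILE 149's `hasMaj_idef_parametrix_comp_cut`), the three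
  partition fits replaced by the three partition-defect rows `hDh`, `hDhs`, `hDdh`; SAME constant.
* §2 ★★ `hasMaj_idef_remainderL_out_tr`, ★ `hasMaj_idef_defectSumL_tr`, ★ `hasMaj_idef_remainderLD_out_tr` — the adjoint remainder-with-defects' η-defect from output-localized
  commutator rows ∕ defects and two-sided defect rows (`…InputLocalized.hasMaj_idef_remainderL_out`, FILE 147 `hasMaj_idef_defectSumL`, FILE 158 `hasMaj_idef_remainderLD_out`).
* §3 ★★★ `hasMaj_idef_glueInvL_comp_tr` — FILE 46's `hasMaj_idef_glueInvL_comp` (`𝔇_τ(Ñ′∘P′, Ñ∘P) = Ñ′∘𝔇_τ(P′,P) + Ñ′∘(𝔇_τ(R̃′,R̃)∘(Ñ∘P))`, exact by n15-c∕332 `idef_neumannR_tr`).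
* §4 ★★★★ `hasMaj_idef_glueInvL_parametrix_comp_cut_of_defect_out_tr` — FILE 158's ★★★: THE TWO-GRID η-DEFECT OF ENTRY 2 `Ñ∘(G₀∘E)` OF THE ADJOINT GLUED OPERATOR WITH DEFECTS
  THROUGH `τ`, from the same data on both grids (adjoint Leibniz rules, cuts, sandwiched right entries `T₂`, cut rows, their `τ`-defects, output-localized commutator rows ∕ defects,
  two-sided defect rows ∕ defects, the three partition-defect rows, the overlap) — SAME constant as the flat namesake.

HONEST FRAMING ∕ LIMITS.  A transport-generic transcription of landed theorems; no estimate; the per-piece `τ`-defect rows and the partition-defect rows are HYPOTHESES; MODEL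
carriers; [Balaban1984PropagatorsII] (2.91)–(2.93) p.239, (2.133)–(2.136) p.247 and [Balaban1985BackgroundPropagators] (3.42) p.397, Thm 3.14 pp.426–427 = MECHANISM ∕ TEMPLATE,
nothing printed is asserted.  NE2⁺ NOT PRINTED, NOT proved; N15 of record untouched (DISCHARGED AS CONSUMED, p687738); K3⁸ OPEN; counts of record UNMOVED (typed 28∕28 · discharged
8∕27); one finite 𝕋⁴ at fixed ε per index — NOT infinite volume, NOT OS on ℝ⁴, NOT a mass gap, NOT Clay.  Restate-immune (no Theses import).
-/

set_option autoImplicit false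

noncomputable section
open scoped BigOperators
open Finset

namespace Summit.QuantumFields.YangMills.BalabanUVNodes.N15.Gluing

open Literature.MathematicalPhysics.QuantumFieldTheory.Balaban1983to89
open Literature.MathematicalPhysics.QuantumFieldTheory.Balaban1983to89.B11SectG (BlockNorm HasMaj RowSum hasMaj_comp hasMaj_comp_exp)
open Literature.MathematicalPhysics.QuantumFieldTheory.Balaban1983to89.T4EtaRateDefect (idef idef_apply idef_comp idef_add idef_sub idef_inv)
open Literature.MathematicalPhysics.QuantumFieldTheory.Balaban1983to89.T4EtaRateCoeffDefect (pull pull_apply diagK diagK_nonneg hasMaj_mulOp)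
open Literature.MathematicalPhysics.QuantumFieldTheory.Balaban1983to89.B6RandomWalk (Triangle254)
open Literature.MathematicalPhysics.QuantumFieldTheory.Balaban1983to89.B6Prop26Gluing (mulOp mulOp_apply ind ind_nonneg ind_le_one)

/-! ## §1 The right-dressed parametrix from cut ∕ sandwiched rows, through a general transport -/

section Parametrix

variable {X X' : Type} [Fintype X] [Fintype X'] {ι : Type} [Fintype ι] {g : B6.Geometry} (blk : X → g.Site) (π : X' → X) (S : ι → Set g.Site)
  (τ : (X → ℝ) →ₗ[ℝ] (X' → ℝ))

/-- ★★ **THE η-DEFECT OF THE RIGHT-DRESSED PARAMETRIX THROUGH `τ`, FROM CUT ∕ SANDWICHED ROWS** — FILE 149 `hasMaj_idef_parametrix_comp_cut` with `pull π ↦ τ`: adjoint Leibniz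
`M_{h_□}∘E = E∘M_{h^s_□} + M_{dh_□}` at both spacings, cuts `M_{h_□}M_{χ_□} = M_{h_□}`, the sandwiched entry-2 operators `(M_χG_□)∘E∘M_{h^s} = T₂,□∘M_{h^s}` (rows `β₂`, `τ`-defect `m₂`),
the cut rows (`β`, `τ`-defect `m₀`), the coarse letters `|h^s| ≤ c_s`, `|dh| ≤ c_d`, fine `|h′| ≤ 1`, the partition-defect ROWS `o`, `o_s`, `o_d`, overlap `≤ N_ov` ⟹
`𝔇_τ(G₀′∘E′, G₀∘E) ≤ N_ov·[(β₂o_s + m₂c_s + oβ₂c_s) + (βo_d + m₀c_d + oβc_d)]·e^{−δd}` (same constant). [cite: Balaban1984PropagatorsII, (2.133), (2.136) p.247 (shapes); Balaban1985BackgroundPropagators, Thm 3.14 pp.426–427 (difference template)] -/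
theorem hasMaj_idef_parametrix_comp_cut_tr {E : (X → ℝ) →ₗ[ℝ] (X → ℝ)} {E' : (X' → ℝ) →ₗ[ℝ] (X' → ℝ)} {h hs dh χ : ι → X → ℝ} {h' hs' dh' χ' : ι → X' → ℝ}
    {G T₂ : ι → (X → ℝ) →ₗ[ℝ] (X → ℝ)} {G' T₂' : ι → (X' → ℝ) →ₗ[ℝ] (X' → ℝ)} {β β₂ cs cd o os od m₀ m₂ δ Nov : ℝ} (hβ : 0 ≤ β) (hβ₂ : 0 ≤ β₂) (hcs : 0 ≤ cs)
    (hcd : 0 ≤ cd) (ho : 0 ≤ o) (hos : 0 ≤ os) (hod : 0 ≤ od) (hm₀ : 0 ≤ m₀) (hm₂ : 0 ≤ m₂)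
    (hleib : ∀ i, mulOp (h i) ∘ₗ E = E ∘ₗ mulOp (hs i) + mulOp (dh i)) (hleib' : ∀ i, mulOp (h' i) ∘ₗ E' = E' ∘ₗ mulOp (hs' i) + mulOp (dh' i))
    (hcut : ∀ i, mulOp (h i) ∘ₗ mulOp (χ i) = mulOp (h i)) (hcut' : ∀ i, mulOp (h' i) ∘ₗ mulOp (χ' i) = mulOp (h' i))
    (hE2 : ∀ i, mulOp (χ i) ∘ₗ G i ∘ₗ E ∘ₗ mulOp (hs i) = T₂ i ∘ₗ mulOp (hs i)) (hE2' : ∀ i, mulOp (χ' i) ∘ₗ G' i ∘ₗ E' ∘ₗ mulOp (hs' i) = T₂' i ∘ₗ mulOp (hs' i))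
    (hh' : ∀ i x', |h' i x'| ≤ 1) (hhs : ∀ i x, |hs i x| ≤ cs) (hdh : ∀ i x, |dh i x| ≤ cd)
    (hDh : ∀ i, HasMaj (BlockNorm.ofBlocks g blk) (BlockNorm.ofBlocks g (blk ∘ π)) (idef τ τ (mulOp (h' i)) (mulOp (h i))) (diagK fun _ => o))
    (hDhs : ∀ i, HasMaj (BlockNorm.ofBlocks g blk) (BlockNorm.ofBlocks g (blk ∘ π)) (idef τ τ (mulOp (hs' i)) (mulOp (hs i))) (diagK fun _ => os))
    (hDdh : ∀ i, HasMaj (BlockNorm.ofBlocks g blk) (BlockNorm.ofBlocks g (blk ∘ π)) (idef τ τ (mulOp (dh' i)) (mulOp (dh i))) (diagK fun _ => od))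
    (hN : ∀ a, ∑ i, ind (S i) a ≤ Nov)
    (hGc : ∀ i, HasMaj (BlockNorm.ofBlocks g blk) (BlockNorm.ofBlocks g blk) (mulOp (χ i) ∘ₗ G i) (fun y y' => ind (S i) y * ind (S i) y' * (β * Real.exp (-(δ * g.dist y y')))))
    (hGc' : ∀ i, HasMaj (BlockNorm.ofBlocks g (blk ∘ π)) (BlockNorm.ofBlocks g (blk ∘ π)) (mulOp (χ' i) ∘ₗ G' i)
      (fun y y' => ind (S i) y * ind (S i) y' * (β * Real.exp (-(δ * g.dist y y')))))
    (hT2 : ∀ i, HasMaj (BlockNorm.ofBlocks g blk) (BlockNorm.ofBlocks g blk) (T₂ i) (fun y y' => ind (S i) y * ind (S i) y' * (β₂ * Real.exp (-(δ * g.dist y y')))))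
    (hT2' : ∀ i, HasMaj (BlockNorm.ofBlocks g (blk ∘ π)) (BlockNorm.ofBlocks g (blk ∘ π)) (T₂' i) (fun y y' => ind (S i) y * ind (S i) y' * (β₂ * Real.exp (-(δ * g.dist y y')))))
    (hIGc : ∀ i, HasMaj (BlockNorm.ofBlocks g blk) (BlockNorm.ofBlocks g (blk ∘ π)) (idef τ τ (mulOp (χ' i) ∘ₗ G' i) (mulOp (χ i) ∘ₗ G i))
      (fun y y' => ind (S i) y * ind (S i) y' * (m₀ * Real.exp (-(δ * g.dist y y')))))
    (hIT2 : ∀ i, HasMaj (BlockNorm.ofBlocks g blk) (BlockNorm.ofBlocks g (blk ∘ π)) (idef τ τ (T₂' i) (T₂ i))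
      (fun y y' => ind (S i) y * ind (S i) y' * (m₂ * Real.exp (-(δ * g.dist y y'))))) :
    HasMaj (BlockNorm.ofBlocks g blk) (BlockNorm.ofBlocks g (blk ∘ π)) (idef τ τ (parametrix h' G' ∘ₗ E') (parametrix h G ∘ₗ E))
      (fun y y' => Nov * ((1 * β₂ * os + 1 * m₂ * cs + o * β₂ * cs) + (1 * β * od + 1 * m₀ * cd + o * β * cd)) * Real.exp (-(δ * g.dist y y'))) := by
  have e1 : ∀ i, mulOp (h i) ∘ₗ T₂ i ∘ₗ mulOp (hs i) = mulOp (h i) ∘ₗ (G i ∘ₗ E) ∘ₗ mulOp (hs i) := fun i => LinearMap.ext fun f => by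
    have h1 := LinearMap.congr_fun (hE2 i) f
    have h2 := LinearMap.congr_fun (hcut i) (G i (E (mulOp (hs i) f)))
    simp only [LinearMap.comp_apply] at h1 h2 ⊢
    rw [← h1, h2]
  have e1' : ∀ i, mulOp (h' i) ∘ₗ T₂' i ∘ₗ mulOp (hs' i) = mulOp (h' i) ∘ₗ (G' i ∘ₗ E') ∘ₗ mulOp (hs' i) := fun i => LinearMap.ext fun f => by
    have h1 := LinearMap.congr_fun (hE2' i) f
    have h2 := LinearMap.congr_fun (hcut' i) (G' i (E' (mulOp (hs' i) f)))
    simp only [LinearMap.comp_apply] at h1 h2 ⊢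
    rw [← h1, h2]
  have e2 : ∀ i, mulOp (h i) ∘ₗ (mulOp (χ i) ∘ₗ G i) ∘ₗ mulOp (dh i) = mulOp (h i) ∘ₗ G i ∘ₗ mulOp (dh i) := fun i =>
    LinearMap.ext fun f => by simp only [LinearMap.comp_apply]; exact LinearMap.congr_fun (hcut i) _
  have e2' : ∀ i, mulOp (h' i) ∘ₗ (mulOp (χ' i) ∘ₗ G' i) ∘ₗ mulOp (dh' i) = mulOp (h' i) ∘ₗ G' i ∘ₗ mulOp (dh' i) := fun i =>
    LinearMap.ext fun f => by simp only [LinearMap.comp_apply]; exact LinearMap.congr_fun (hcut' i) _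
  have hterm : ∀ i, HasMaj (BlockNorm.ofBlocks g blk) (BlockNorm.ofBlocks g (blk ∘ π))
      (idef τ τ (mulOp (h' i) ∘ₗ (G' i ∘ₗ E') ∘ₗ mulOp (hs' i) + mulOp (h' i) ∘ₗ G' i ∘ₗ mulOp (dh' i))
        (mulOp (h i) ∘ₗ (G i ∘ₗ E) ∘ₗ mulOp (hs i) + mulOp (h i) ∘ₗ G i ∘ₗ mulOp (dh i)))
      (fun y y' => ind (S i) y * (((1 * β₂ * os + 1 * m₂ * cs + o * β₂ * cs) + (1 * β * od + 1 * m₀ * cd + o * β * cd)) * Real.exp (-(δ * g.dist y y')))) := fun i => by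
    have t1 := hasMaj_idef_sandwich_loc_tr blk π τ zero_le_one hcs ho hβ₂ hm₂ (hh' i) (hhs i) (hDh i) (hDhs i) (hT2 i) (hT2' i) (hIT2 i)
    have t2 := hasMaj_idef_sandwich_loc_tr blk π τ zero_le_one hcd ho hβ hm₀ (hh' i) (hdh i) (hDh i) (hDdh i) (hGc i) (hGc' i) (hIGc i)
    rw [e1 i, e1' i] at t1
    rw [e2 i, e2' i] at t2
    rw [idef_add]
    refine (t1.add t2).mono fun y y' => ?_
    have key := ind_mul_ind_le (Sc := S i) (A := ((1 * β₂ * os + 1 * m₂ * cs + o * β₂ * cs) + (1 * β * od + 1 * m₀ * cd + o * β * cd)) * Real.exp (-(δ * g.dist y y')))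
      (mul_nonneg (by positivity) (Real.exp_nonneg _)) y y'
    calc ind (S i) y * ind (S i) y' * ((1 * β₂ * os + 1 * m₂ * cs + o * β₂ * cs) * Real.exp (-(δ * g.dist y y'))) +
          ind (S i) y * ind (S i) y' * ((1 * β * od + 1 * m₀ * cd + o * β * cd) * Real.exp (-(δ * g.dist y y')))
        = ind (S i) y * ind (S i) y' * (((1 * β₂ * os + 1 * m₂ * cs + o * β₂ * cs) + (1 * β * od + 1 * m₀ * cd + o * β * cd)) * Real.exp (-(δ * g.dist y y'))) := by
          ring
      _ ≤ _ := key
  rw [parametrix_comp_of_leibniz hleib, parametrix_comp_of_leibniz hleib', idef_fsum_tr τ]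
  refine (hasMaj_sum_overlap _ S _ Nov (fun y y' => mul_nonneg (by positivity) (Real.exp_nonneg _)) hterm hN).mono fun y y' => le_of_eq ?_
  ring

end Parametrix

/-! ## §2 The adjoint remainder with defects, through a general transport -/

section Letters

variable {X X' : Type} [Fintype X] [Fintype X'] {ι : Type} [Fintype ι] {g : B6.Geometry} (blk : X → g.Site) (π : X' → X) (S : ι → Set g.Site)
  (τ : (X → ℝ) →ₗ[ℝ] (X' → ℝ))

/-- ★★ **THE ADJOINT REMAINDER's η-DEFECT THROUGH `τ` from output-localized rows** — `…InputLocalized.hasMaj_idef_remainderL_out` with `pull π ↦ τ`: coarse rows `θ₀`, row defects `r`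
(both `1_{S_□}(y)`-localized), the fine `|h′| ≤ 1`, the partition-defect row `o` ⟹ `𝔇_τ(R̃′, R̃) ≤ N_ov(r + oθ₀)·e^{−δd}`.
[cite: Balaban1984PropagatorsII, (2.134)–(2.135) p.247 (shapes, transposed); Balaban1985BackgroundPropagators, Thm 3.14 pp.426–427 (template)] -/
theorem hasMaj_idef_remainderL_out_tr {Δ : (X → ℝ) →ₗ[ℝ] (X → ℝ)} {Δ' : (X' → ℝ) →ₗ[ℝ] (X' → ℝ)} {h : ι → X → ℝ} {h' : ι → X' → ℝ} {G : ι → (X → ℝ) →ₗ[ℝ] (X → ℝ)}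
    {G' : ι → (X' → ℝ) →ₗ[ℝ] (X' → ℝ)} {θ₀ r o δ Nov : ℝ} (hθ : 0 ≤ θ₀) (hr : 0 ≤ r) (ho : 0 ≤ o) (hh' : ∀ i x', |h' i x'| ≤ 1)
    (hDh : ∀ i, HasMaj (BlockNorm.ofBlocks g blk) (BlockNorm.ofBlocks g (blk ∘ π)) (idef τ τ (mulOp (h' i)) (mulOp (h i))) (diagK fun _ => o))
    (hN : ∀ a, ∑ i, ind (S i) a ≤ Nov)
    (hKc : ∀ i, HasMaj (BlockNorm.ofBlocks g blk) (BlockNorm.ofBlocks g blk) (G i ∘ₗ commOp Δ (h i)) (fun y y' => ind (S i) y * (θ₀ * Real.exp (-(δ * g.dist y y')))))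
    (hDK : ∀ i, HasMaj (BlockNorm.ofBlocks g blk) (BlockNorm.ofBlocks g (blk ∘ π)) (idef τ τ (G' i ∘ₗ commOp Δ' (h' i)) (G i ∘ₗ commOp Δ (h i)))
      (fun y y' => ind (S i) y * (r * Real.exp (-(δ * g.dist y y'))))) :
    HasMaj (BlockNorm.ofBlocks g blk) (BlockNorm.ofBlocks g (blk ∘ π)) (idef τ τ (remainderL Δ' h' G') (remainderL Δ h G))
      (fun y y' => Nov * (r + o * θ₀) * Real.exp (-(δ * g.dist y y'))) := by
  have hterm : ∀ i, HasMaj (BlockNorm.ofBlocks g blk) (BlockNorm.ofBlocks g (blk ∘ π))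
      (idef τ τ (mulOp (h' i) ∘ₗ (G' i ∘ₗ commOp Δ' (h' i))) (mulOp (h i) ∘ₗ (G i ∘ₗ commOp Δ (h i))))
      (fun y y' => ind (S i) y * ((r + o * θ₀) * Real.exp (-(δ * g.dist y y')))) := fun i => by
    have hMa' := hasMaj_mulOp (g := g) (blk ∘ π) (m := fun _ => (1 : ℝ)) (fun _ => zero_le_one) (hh' i)
    have hDM := hDh i
    have t1 := hasMaj_diag_comp (blk ∘ π) (fun _ => zero_le_one) hMa' (hDK i)
    have t2 := hasMaj_diag_comp blk (fun _ => ho) hDM (hKc i)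
    rw [idef_comp τ τ τ]
    refine (t1.add t2).mono fun y y' => le_of_eq ?_
    ring
  rw [remainderL, remainderL, idef_fsum_tr τ]
  refine (hasMaj_sum_overlap _ S _ Nov (fun y y' => mul_nonneg (by positivity) (Real.exp_nonneg _)) hterm hN).mono fun y y' => le_of_eq ?_
  ring

/-- ★ **THE ADJOINT DEFECT SUM's η-DEFECT THROUGH `τ`** — FILE 147 `hasMaj_idef_defectSumL` with `pull π ↦ τ`: coarse defect rows `Ẽ_□ ≤ 1_S1_S·εe^{−δd}`, their `τ`-defects
`𝔇_τ(Ẽ′_□, Ẽ_□) ≤ 1_S1_S·r_Ee^{−δd}`, fine `|h′_□| ≤ 1`, the partition-defect row `o`, overlap ⟹ `𝔇_τ(Σ_□M_{h′_□}Ẽ′_□, Σ_□M_{h_□}Ẽ_□) ≤ N_ov(r_E + oε)·e^{−δd}`.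
[cite: Balaban1985BackgroundPropagators, Thm 3.14 pp.426–427 (difference template); Balaban1984PropagatorsII, (2.135) p.247] -/
theorem hasMaj_idef_defectSumL_tr {h : ι → X → ℝ} {h' : ι → X' → ℝ} {E : ι → (X → ℝ) →ₗ[ℝ] (X → ℝ)} {E' : ι → (X' → ℝ) →ₗ[ℝ] (X' → ℝ)} {ε rE o δ Nov : ℝ} (hε : 0 ≤ ε)
    (hrE : 0 ≤ rE) (ho : 0 ≤ o) (hh' : ∀ i x', |h' i x'| ≤ 1)
    (hDh : ∀ i, HasMaj (BlockNorm.ofBlocks g blk) (BlockNorm.ofBlocks g (blk ∘ π)) (idef τ τ (mulOp (h' i)) (mulOp (h i))) (diagK fun _ => o))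
    (hN : ∀ a, ∑ i, ind (S i) a ≤ Nov)
    (hE : ∀ i, HasMaj (BlockNorm.ofBlocks g blk) (BlockNorm.ofBlocks g blk) (E i) (fun y y' => ind (S i) y * ind (S i) y' * (ε * Real.exp (-(δ * g.dist y y')))))
    (hDE : ∀ i, HasMaj (BlockNorm.ofBlocks g blk) (BlockNorm.ofBlocks g (blk ∘ π)) (idef τ τ (E' i) (E i)) (fun y y' => ind (S i) y * ind (S i) y' * (rE * Real.exp (-(δ * g.dist y y'))))) :
    HasMaj (BlockNorm.ofBlocks g blk) (BlockNorm.ofBlocks g (blk ∘ π)) (idef τ τ (∑ i, mulOp (h' i) ∘ₗ E' i) (∑ i, mulOp (h i) ∘ₗ E i))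
      (fun y y' => Nov * ((1 * rE + o * ε) * Real.exp (-(δ * g.dist y y')))) := by
  have hterm : ∀ i, HasMaj (BlockNorm.ofBlocks g blk) (BlockNorm.ofBlocks g (blk ∘ π)) (idef τ τ (mulOp (h' i) ∘ₗ E' i) (mulOp (h i) ∘ₗ E i))
      (fun y y' => ind (S i) y * ((1 * rE + o * ε) * Real.exp (-(δ * g.dist y y')))) := fun i => by
    have hMa' := hasMaj_mulOp (g := g) (blk ∘ π) (m := fun _ => (1 : ℝ)) (fun _ => zero_le_one) (hh' i)
    have hDM := hDh i
    have t1 := hasMaj_diag_comp (blk ∘ π) (fun _ => zero_le_one) hMa' (hDE i)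
    have t2 := hasMaj_diag_comp blk (fun _ => ho) hDM (hE i)
    rw [idef_comp τ τ τ]
    refine (t1.add t2).mono fun y y' => ?_
    have key := ind_mul_ind_le (Sc := S i) (A := (1 * rE + o * ε) * Real.exp (-(δ * g.dist y y'))) (mul_nonneg (by positivity) (Real.exp_nonneg _)) y y'
    calc 1 * (ind (S i) y * ind (S i) y' * (rE * Real.exp (-(δ * g.dist y y')))) + o * (ind (S i) y * ind (S i) y' * (ε * Real.exp (-(δ * g.dist y y'))))
        = ind (S i) y * ind (S i) y' * ((1 * rE + o * ε) * Real.exp (-(δ * g.dist y y'))) := by ring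
      _ ≤ _ := key
  rw [idef_fsum_tr τ]
  exact hasMaj_sum_overlap (b₁ := BlockNorm.ofBlocks g blk) (b₃ := BlockNorm.ofBlocks g (blk ∘ π)) _ S _ Nov (fun y y' => mul_nonneg (by positivity) (Real.exp_nonneg _)) hterm hN

/-- ★ **THE FULL ADJOINT REMAINDER's η-DEFECT THROUGH `τ`, OUTPUT-LOCALIZED COMMUTATOR ROWS AND DEFECTS** — FILE 158 `hasMaj_idef_remainderLD_out` with `pull π ↦ τ`:
`𝔇_τ(R̃′_D, R̃_D) ≤ N_ov(r + oθ₀ + (1·r_E + oε))·e^{−δd}`. [cite: Balaban1985BackgroundPropagators, Thm 3.14 pp.426–427 (template); Balaban1984PropagatorsII, (2.134)–(2.135) p.247 (shapes)] -/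
theorem hasMaj_idef_remainderLD_out_tr {Δ : (X → ℝ) →ₗ[ℝ] (X → ℝ)} {Δ' : (X' → ℝ) →ₗ[ℝ] (X' → ℝ)} {h : ι → X → ℝ} {h' : ι → X' → ℝ} {G E : ι → (X → ℝ) →ₗ[ℝ] (X → ℝ)}
    {G' E' : ι → (X' → ℝ) →ₗ[ℝ] (X' → ℝ)} {θ₀ r ε rE o δ Nov : ℝ} (hθ : 0 ≤ θ₀) (hr : 0 ≤ r) (hε : 0 ≤ ε) (hrE : 0 ≤ rE) (ho : 0 ≤ o) (hh' : ∀ i x', |h' i x'| ≤ 1)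
    (hDh : ∀ i, HasMaj (BlockNorm.ofBlocks g blk) (BlockNorm.ofBlocks g (blk ∘ π)) (idef τ τ (mulOp (h' i)) (mulOp (h i))) (diagK fun _ => o))
    (hN : ∀ a, ∑ i, ind (S i) a ≤ Nov)
    (hKc : ∀ i, HasMaj (BlockNorm.ofBlocks g blk) (BlockNorm.ofBlocks g blk) (G i ∘ₗ commOp Δ (h i)) (fun y y' => ind (S i) y * (θ₀ * Real.exp (-(δ * g.dist y y')))))
    (hDK : ∀ i, HasMaj (BlockNorm.ofBlocks g blk) (BlockNorm.ofBlocks g (blk ∘ π)) (idef τ τ (G' i ∘ₗ commOp Δ' (h' i)) (G i ∘ₗ commOp Δ (h i)))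
      (fun y y' => ind (S i) y * (r * Real.exp (-(δ * g.dist y y')))))
    (hE : ∀ i, HasMaj (BlockNorm.ofBlocks g blk) (BlockNorm.ofBlocks g blk) (E i) (fun y y' => ind (S i) y * ind (S i) y' * (ε * Real.exp (-(δ * g.dist y y')))))
    (hDE : ∀ i, HasMaj (BlockNorm.ofBlocks g blk) (BlockNorm.ofBlocks g (blk ∘ π)) (idef τ τ (E' i) (E i)) (fun y y' => ind (S i) y * ind (S i) y' * (rE * Real.exp (-(δ * g.dist y y'))))) :
    HasMaj (BlockNorm.ofBlocks g blk) (BlockNorm.ofBlocks g (blk ∘ π))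
      (idef τ τ (remainderL Δ' h' G' - ∑ i, mulOp (h' i) ∘ₗ E' i) (remainderL Δ h G - ∑ i, mulOp (h i) ∘ₗ E i))
      (fun y y' => Nov * (r + o * θ₀ + (1 * rE + o * ε)) * Real.exp (-(δ * g.dist y y'))) := by
  rw [idef_sub]
  refine ((hasMaj_idef_remainderL_out_tr blk π S τ hθ hr ho hh' hDh hN hKc hDK).sub (hasMaj_idef_defectSumL_tr blk π S τ hε hrE ho hh' hDh hN hE hDE)).mono
    fun y y' => le_of_eq ?_
  ring

end Letters

/-! ## §3 The adjoint arrangement with a right factor, through a general transport -/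

section Adjoint

variable {X X' : Type} [Fintype X] [Fintype X'] [DecidableEq X] [DecidableEq X'] {g : B6.Geometry} (blk : X → g.Site) (π : X' → X) {σ cr : ℝ}
  (τ : (X → ℝ) →ₗ[ℝ] (X' → ℝ))

/-- ★★★ **THE η-DEFECT OF THE ADJOINT ARRANGEMENT WITH A RIGHT FACTOR THROUGH `τ`** — FILE 46 `hasMaj_idef_glueInvL_comp` with `pull π ↦ τ`: right-dressed parametrices
`P = G₀∘E ≤ Ae^{−δd}` (coarse) with `τ`-defect `𝔇_τ(P′,P) ≤ me^{−δd}`, remainders `R, R′ ≤ θe^{−δd}` with `τ`-defect `𝔇_τ(R′,R) ≤ re^{−δd}`, `q = θc_r < 1`, `2σ ≤ δ` ⟹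
`𝔇_τ(Ñ′∘P′, Ñ∘P) = Ñ′∘𝔇_τ(P′,P) + Ñ′∘(𝔇_τ(R̃′,R̃)∘(Ñ∘P)) ≤ [m(1−q)⁻¹c_r + Ar(1−q)⁻²c_r³]·e^{−(δ−2σ)d}` (exact splitting: n15-c∕332 `idef_neumannR_tr`).
[cite: Balaban1984PropagatorsII, Prop. 2.6 (2.136) p.247 (entries: shape); (2.52)–(2.56) pp.232–233 (mechanism)] -/
theorem hasMaj_idef_glueInvL_comp_tr (htri : Triangle254 g) (hd : ∀ a b : g.Site, 0 ≤ g.dist a b) (hd0 : ∀ y : g.Site, g.dist y y = 0) (hrow : RowSum g σ cr) (hσ : 0 ≤ σ)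
    (hcr : 0 ≤ cr) {P R : (X → ℝ) →ₗ[ℝ] (X → ℝ)} {P' R' : (X' → ℝ) →ₗ[ℝ] (X' → ℝ)} {A θ m r δ : ℝ} (hA : 0 ≤ A) (hθ : 0 ≤ θ) (hm : 0 ≤ m) (hr : 0 ≤ r)
    (hσδ : 2 * σ ≤ δ)
    (hP : HasMaj (BlockNorm.ofBlocks g blk) (BlockNorm.ofBlocks g blk) P (fun y y' => A * Real.exp (-(δ * g.dist y y'))))
    (hR : HasMaj (BlockNorm.ofBlocks g blk) (BlockNorm.ofBlocks g blk) R (fun y y' => θ * Real.exp (-(δ * g.dist y y'))))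
    (hR' : HasMaj (BlockNorm.ofBlocks g (blk ∘ π)) (BlockNorm.ofBlocks g (blk ∘ π)) R' (fun y y' => θ * Real.exp (-(δ * g.dist y y'))))
    (hDP : HasMaj (BlockNorm.ofBlocks g blk) (BlockNorm.ofBlocks g (blk ∘ π)) (idef τ τ P' P) (fun y y' => m * Real.exp (-(δ * g.dist y y'))))
    (hDR : HasMaj (BlockNorm.ofBlocks g blk) (BlockNorm.ofBlocks g (blk ∘ π)) (idef τ τ R' R) (fun y y' => r * Real.exp (-(δ * g.dist y y'))))
    (hq : θ * cr < 1) :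
    HasMaj (BlockNorm.ofBlocks g blk) (BlockNorm.ofBlocks g (blk ∘ π)) (idef τ τ (neumannR R' ∘ₗ P') (neumannR R ∘ₗ P))
      (fun y y' => ((1 - θ * cr)⁻¹ * m * cr + (1 - θ * cr)⁻¹ * (r * ((1 - θ * cr)⁻¹ * A * cr) * cr) * cr) * Real.exp (-((δ - 2 * σ) * g.dist y y'))) := by
  have hσδ' : σ ≤ δ := by linarith
  have hunit := isUnit_neumannR blk hd hrow hθ hσδ' hR hq
  have hunit' := isUnit_neumannR (blk ∘ π) hd hrow hθ hσδ' hR' hq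
  have hinv0 : 0 ≤ (1 - θ * cr)⁻¹ := inv_nonneg.2 (by linarith)
  have hN := hasMaj_neumannR blk htri hd hd0 hrow (ρ := δ - σ) hθ (by linarith) (by linarith) hR hq
  have hN' := hasMaj_neumannR (blk ∘ π) htri hd hd0 hrow (ρ := δ - σ) hθ (by linarith) (by linarith) hR' hq
  -- term 1: `Ñ′ ∘ 𝔇_τ(P′,P)` at rate `δ − 2σ`
  have h1 := hasMaj_comp_exp (b₁ := BlockNorm.ofBlocks g blk) (b₂ := BlockNorm.ofBlocks g (blk ∘ π)) (b₃ := BlockNorm.ofBlocks g (blk ∘ π))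
    (T₁ := neumannR R') (T₂ := idef τ τ P' P) (ρ := δ - 2 * σ) htri hd hrow hinv0 hm (by linarith) (by linarith) (by linarith) hN' hDP
  -- term 2: `Ñ′ ∘ (𝔇_τ(R̃′,R̃) ∘ (Ñ ∘ P))`, innermost first
  have h2a := hasMaj_comp_exp (b₁ := BlockNorm.ofBlocks g blk) (b₂ := BlockNorm.ofBlocks g blk) (b₃ := BlockNorm.ofBlocks g blk)
    (T₁ := neumannR R) (T₂ := P) (ρ := δ - 2 * σ) htri hd hrow hinv0 hA (by linarith) (by linarith) (by linarith) hN hP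
  have h2a' : HasMaj (BlockNorm.ofBlocks g blk) (BlockNorm.ofBlocks g blk) (neumannR R ∘ₗ P)
      (fun y y' => (1 - θ * cr)⁻¹ * A * cr * Real.exp (-((δ - 2 * σ) * g.dist y y'))) := by
    refine h2a.mono fun a b => le_of_eq ?_
    rw [show (BlockNorm.ofBlocks g blk).κ = 1 from rfl]
    ring
  have h2b := hasMaj_comp_exp (b₁ := BlockNorm.ofBlocks g blk) (b₂ := BlockNorm.ofBlocks g blk) (b₃ := BlockNorm.ofBlocks g (blk ∘ π))
    (T₁ := idef τ τ R' R) (T₂ := neumannR R ∘ₗ P) (ρ := δ - 2 * σ) htri hd hrow hr (mul_nonneg (mul_nonneg hinv0 hA) hcr)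
    (by linarith) le_rfl (by linarith) hDR h2a'
  have h2b' : HasMaj (BlockNorm.ofBlocks g blk) (BlockNorm.ofBlocks g (blk ∘ π)) (idef τ τ R' R ∘ₗ (neumannR R ∘ₗ P))
      (fun y y' => r * ((1 - θ * cr)⁻¹ * A * cr) * cr * Real.exp (-((δ - 2 * σ) * g.dist y y'))) := by
    refine h2b.mono fun a b => le_of_eq ?_
    rw [show (BlockNorm.ofBlocks g blk).κ = 1 from rfl]
    ring
  have h2c := hasMaj_comp_exp (b₁ := BlockNorm.ofBlocks g blk) (b₂ := BlockNorm.ofBlocks g (blk ∘ π)) (b₃ := BlockNorm.ofBlocks g (blk ∘ π))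
    (T₁ := neumannR R') (T₂ := idef τ τ R' R ∘ₗ (neumannR R ∘ₗ P)) (ρ := δ - 2 * σ) htri hd hrow hinv0
    (mul_nonneg (mul_nonneg hr (mul_nonneg (mul_nonneg hinv0 hA) hcr)) hcr) (by linarith) le_rfl (by linarith) hN' h2b'
  -- assemble
  have hop : idef τ τ (neumannR R' ∘ₗ P') (neumannR R ∘ₗ P) =
      neumannR R' ∘ₗ idef τ τ P' P + neumannR R' ∘ₗ (idef τ τ R' R ∘ₗ (neumannR R ∘ₗ P)) := by
    rw [idef_comp τ τ τ, idef_neumannR_tr τ hunit hunit', LinearMap.comp_assoc, LinearMap.comp_assoc]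
  rw [hop]
  refine (h1.add h2c).mono fun a b => le_of_eq ?_
  rw [show (BlockNorm.ofBlocks g (blk ∘ π)).κ = 1 from rfl]
  ring

end Adjoint

/-! ## §4 Entry 2 of the adjoint glued operator with defects, through a general transport -/

section Entry

variable {X X' : Type} [Fintype X] [Fintype X'] [DecidableEq X] [DecidableEq X'] {ι : Type} [Fintype ι] {g : B6.Geometry} (blk : X → g.Site) (π : X' → X)
  (S : ι → Set g.Site) {σ cr : ℝ} (τ : (X → ℝ) →ₗ[ℝ] (X' → ℝ))

/-- ★★★★ **THE TWO-GRID η-DEFECT OF ENTRY 2 `Ñ∘(G₀∘E)` OF THE ADJOINT GLUED OPERATOR WITH DEFECTS THROUGH A GENERAL TRANSPORT `τ`** — FILE 158 ★★★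
`hasMaj_idef_glueInvL_parametrix_comp_cut_of_defect_out` with `pull π ↦ τ` and the three partition fits replaced by the partition-defect rows `hDh`, `hDhs`, `hDdh`:
`𝔇_τ(Ñ′∘(G₀′∘E′), Ñ∘(G₀∘E)) ≤ [(1−q)⁻¹m̂c_r + (1−q)⁻¹(r̂((1−q)⁻¹Âc_r)c_r)c_r]·e^{−(δ−2σ)d}`, `q = N_ov(θ₀+ε)c_r`, `Â = N_ov(β₂c_s + βc_d)`, `r̂ = N_ov(r + oθ₀ + (1·r_E + oε))`,
`m̂ = N_ov[(1·β₂o_s + 1·m₂c_s + oβ₂c_s) + (1·βo_d + 1·m₀c_d + oβc_d)]` — SAME constant as the flat namesake.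
[cite: Balaban1985BackgroundPropagators, Thm 3.14 pp.426–427 (difference template), (3.42) p.397 (third entry: shape); Balaban1984PropagatorsII, (2.91)–(2.93) p.239, (2.133)–(2.136) p.247] -/
theorem hasMaj_idef_glueInvL_parametrix_comp_cut_of_defect_out_tr (htri : Triangle254 g) (hd : ∀ a b : g.Site, 0 ≤ g.dist a b) (hd0 : ∀ y : g.Site, g.dist y y = 0)
    (hrow : RowSum g σ cr) (hσ : 0 ≤ σ) (hcr : 0 ≤ cr) {Δ E : (X → ℝ) →ₗ[ℝ] (X → ℝ)} {Δ' E' : (X' → ℝ) →ₗ[ℝ] (X' → ℝ)} {h hs dh χ : ι → X → ℝ} {h' hs' dh' χ' : ι → X' → ℝ}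
    {G T₂ Ed : ι → (X → ℝ) →ₗ[ℝ] (X → ℝ)} {G' T₂' Ed' : ι → (X' → ℝ) →ₗ[ℝ] (X' → ℝ)} {β β₂ cs cd o os od m₀ m₂ θ₀ ε r rE δ Nov : ℝ} (hβ : 0 ≤ β) (hβ₂ : 0 ≤ β₂) (hcs : 0 ≤ cs)
    (hcd : 0 ≤ cd) (ho : 0 ≤ o) (hos : 0 ≤ os) (hod : 0 ≤ od) (hm₀ : 0 ≤ m₀) (hm₂ : 0 ≤ m₂) (hθ : 0 ≤ θ₀) (hε : 0 ≤ ε) (hr : 0 ≤ r) (hrE : 0 ≤ rE) (hNov : 0 ≤ Nov) (hσδ : 2 * σ ≤ δ)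
    (hleib : ∀ i, mulOp (h i) ∘ₗ E = E ∘ₗ mulOp (hs i) + mulOp (dh i)) (hleib' : ∀ i, mulOp (h' i) ∘ₗ E' = E' ∘ₗ mulOp (hs' i) + mulOp (dh' i))
    (hcut : ∀ i, mulOp (h i) ∘ₗ mulOp (χ i) = mulOp (h i)) (hcut' : ∀ i, mulOp (h' i) ∘ₗ mulOp (χ' i) = mulOp (h' i))
    (hE2 : ∀ i, mulOp (χ i) ∘ₗ G i ∘ₗ E ∘ₗ mulOp (hs i) = T₂ i ∘ₗ mulOp (hs i)) (hE2' : ∀ i, mulOp (χ' i) ∘ₗ G' i ∘ₗ E' ∘ₗ mulOp (hs' i) = T₂' i ∘ₗ mulOp (hs' i))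
    (hh : ∀ i x, |h i x| ≤ 1) (hh' : ∀ i x', |h' i x'| ≤ 1) (hhs : ∀ i x, |hs i x| ≤ cs) (hdh : ∀ i x, |dh i x| ≤ cd)
    (hDh : ∀ i, HasMaj (BlockNorm.ofBlocks g blk) (BlockNorm.ofBlocks g (blk ∘ π)) (idef τ τ (mulOp (h' i)) (mulOp (h i))) (diagK fun _ => o))
    (hDhs : ∀ i, HasMaj (BlockNorm.ofBlocks g blk) (BlockNorm.ofBlocks g (blk ∘ π)) (idef τ τ (mulOp (hs' i)) (mulOp (hs i))) (diagK fun _ => os))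
    (hDdh : ∀ i, HasMaj (BlockNorm.ofBlocks g blk) (BlockNorm.ofBlocks g (blk ∘ π)) (idef τ τ (mulOp (dh' i)) (mulOp (dh i))) (diagK fun _ => od))
    (hN : ∀ b, ∑ i, ind (S i) b ≤ Nov)
    (hGc : ∀ i, HasMaj (BlockNorm.ofBlocks g blk) (BlockNorm.ofBlocks g blk) (mulOp (χ i) ∘ₗ G i) (fun y y' => ind (S i) y * ind (S i) y' * (β * Real.exp (-(δ * g.dist y y')))))
    (hGc' : ∀ i, HasMaj (BlockNorm.ofBlocks g (blk ∘ π)) (BlockNorm.ofBlocks g (blk ∘ π)) (mulOp (χ' i) ∘ₗ G' i)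
      (fun y y' => ind (S i) y * ind (S i) y' * (β * Real.exp (-(δ * g.dist y y')))))
    (hT2 : ∀ i, HasMaj (BlockNorm.ofBlocks g blk) (BlockNorm.ofBlocks g blk) (T₂ i) (fun y y' => ind (S i) y * ind (S i) y' * (β₂ * Real.exp (-(δ * g.dist y y')))))
    (hT2' : ∀ i, HasMaj (BlockNorm.ofBlocks g (blk ∘ π)) (BlockNorm.ofBlocks g (blk ∘ π)) (T₂' i) (fun y y' => ind (S i) y * ind (S i) y' * (β₂ * Real.exp (-(δ * g.dist y y')))))
    (hIGc : ∀ i, HasMaj (BlockNorm.ofBlocks g blk) (BlockNorm.ofBlocks g (blk ∘ π)) (idef τ τ (mulOp (χ' i) ∘ₗ G' i) (mulOp (χ i) ∘ₗ G i))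
      (fun y y' => ind (S i) y * ind (S i) y' * (m₀ * Real.exp (-(δ * g.dist y y')))))
    (hIT2 : ∀ i, HasMaj (BlockNorm.ofBlocks g blk) (BlockNorm.ofBlocks g (blk ∘ π)) (idef τ τ (T₂' i) (T₂ i))
      (fun y y' => ind (S i) y * ind (S i) y' * (m₂ * Real.exp (-(δ * g.dist y y')))))
    (hKc : ∀ i, HasMaj (BlockNorm.ofBlocks g blk) (BlockNorm.ofBlocks g blk) (G i ∘ₗ commOp Δ (h i)) (fun y y' => ind (S i) y * (θ₀ * Real.exp (-(δ * g.dist y y')))))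
    (hKc' : ∀ i, HasMaj (BlockNorm.ofBlocks g (blk ∘ π)) (BlockNorm.ofBlocks g (blk ∘ π)) (G' i ∘ₗ commOp Δ' (h' i)) (fun y y' => ind (S i) y * (θ₀ * Real.exp (-(δ * g.dist y y')))))
    (hDK : ∀ i, HasMaj (BlockNorm.ofBlocks g blk) (BlockNorm.ofBlocks g (blk ∘ π)) (idef τ τ (G' i ∘ₗ commOp Δ' (h' i)) (G i ∘ₗ commOp Δ (h i)))
      (fun y y' => ind (S i) y * (r * Real.exp (-(δ * g.dist y y')))))
    (hEd : ∀ i, HasMaj (BlockNorm.ofBlocks g blk) (BlockNorm.ofBlocks g blk) (Ed i) (fun y y' => ind (S i) y * ind (S i) y' * (ε * Real.exp (-(δ * g.dist y y')))))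
    (hEd' : ∀ i, HasMaj (BlockNorm.ofBlocks g (blk ∘ π)) (BlockNorm.ofBlocks g (blk ∘ π)) (Ed' i) (fun y y' => ind (S i) y * ind (S i) y' * (ε * Real.exp (-(δ * g.dist y y')))))
    (hDEd : ∀ i, HasMaj (BlockNorm.ofBlocks g blk) (BlockNorm.ofBlocks g (blk ∘ π)) (idef τ τ (Ed' i) (Ed i)) (fun y y' => ind (S i) y * ind (S i) y' * (rE * Real.exp (-(δ * g.dist y y')))))
    (hq : Nov * (θ₀ + ε) * cr < 1) :
    HasMaj (BlockNorm.ofBlocks g blk) (BlockNorm.ofBlocks g (blk ∘ π))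
      (idef τ τ (glueInvL (remainderL Δ' h' G' - ∑ i, mulOp (h' i) ∘ₗ Ed' i) (parametrix h' G') ∘ₗ E')
        (glueInvL (remainderL Δ h G - ∑ i, mulOp (h i) ∘ₗ Ed i) (parametrix h G) ∘ₗ E))
      (fun y y' => ((1 - Nov * (θ₀ + ε) * cr)⁻¹ * (Nov * ((1 * β₂ * os + 1 * m₂ * cs + o * β₂ * cs) + (1 * β * od + 1 * m₀ * cd + o * β * cd))) * cr +
          (1 - Nov * (θ₀ + ε) * cr)⁻¹ * ((Nov * (r + o * θ₀ + (1 * rE + o * ε))) * ((1 - Nov * (θ₀ + ε) * cr)⁻¹ * (Nov * (β₂ * cs + β * cd)) * cr) * cr) * cr) *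
        Real.exp (-((δ - 2 * σ) * g.dist y y'))) := by
  have hP := hasMaj_parametrix_comp_cut blk S hβ hβ₂ hcs hcd hleib hcut hE2 hh hhs hdh hN hGc hT2
  have hIP := hasMaj_idef_parametrix_comp_cut_tr blk π S τ hβ hβ₂ hcs hcd ho hos hod hm₀ hm₂ hleib hleib' hcut hcut' hE2 hE2' hh' hhs hdh hDh hDhs hDdh hN hGc hGc' hT2 hT2' hIGc hIT2
  rw [glueInvL, glueInvL, LinearMap.comp_assoc, LinearMap.comp_assoc]
  exact hasMaj_idef_glueInvL_comp_tr blk π τ htri hd hd0 hrow hσ hcr (by positivity) (mul_nonneg hNov (add_nonneg hθ hε)) (mul_nonneg hNov (by positivity))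
    (mul_nonneg hNov (by positivity)) hσδ hP (hasMaj_remainderLD_out blk S hθ hε hh hN hKc hEd) (hasMaj_remainderLD_out (blk ∘ π) S hθ hε hh' hN hKc' hEd') hIP
    (hasMaj_idef_remainderLD_out_tr blk π S τ hθ hr hε hrE ho hh' hDh hN hKc hDK hEd hDEd) hq

end Entry

end Summit.QuantumFields.YangMills.BalabanUVNodes.N15.Gluing

end
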